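import Mathlib
import HarnessLib
import Summits.HubbardSuperconductivity.HubbardSuperconductivity.Theorems.KLProgrammeKLRegimeVolumeLimitV11TowerDataWOfHE1Free
import Summits.HubbardSuperconductivity.HubbardSuperconductivity.Theorems.KLProgrammeKLRegimeVolumeLimitV12EndDoorsWB
import Summits.HubbardSuperconductivity.HubbardSuperconductivity.Theorems.KLProgrammeKLRegimeTwoVolumeTowerTruncCloserLevSW
import Summits.HubbardSuperconductivity.HubbardSuperconductivity.Theorems.KLProgrammeKLRegimeVolumeLimitFlowFramesV17F3
import Summits.HubbardSuperconductivity.HubbardSuperconductivity.Theorems.KLProgrammeKLRegimeTwoVolumeSrcTowerProducer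
import Summits.HubbardSuperconductivity.HubbardSuperconductivity.Theses.KLProgramme

/-!
# Route `KLProgramme` — crux K3, VL child `KLRegimeVolumeLimitV17F3` (stmt-HubbardSuperconductivity-23356), producer route «(VL)-SRC-SOFT» §S6:
# THE CONSUMERS RE-KEYED TO THE HISTORY-BOUND PRODUCER, AND THE CHILD FROM THREE ENGINE-LINEAGE ATOMS (seat hubbard-kl-k3c4-p1 g19; `--supports` 23356)

`…TwoVolumeSrcTowerProducer.srcProfilesH_of_atoms` proves token #24 at every level with the amplitude produced AFTER the tower hypothesis
`TowerP klPredsV17F2 G P Q R β U μ K Lstar Mstar`.  Both consumers of the producer text read it exactly where that hypothesis is in scope, so they are re-keyed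
verbatim (two `obtain`s move under `hT`, the producer is read at `(G, P, Q, R)` instead of `(P, R₁)`):
* `vl_towerDataW_WF2_of_atomsB_srcH` — twin of `…V11TowerDataWOfHE1Free.stub_vl_towerDataW_WF2_of_atomsB_free`;
* `vl_nestedFramed_of_gluedWindowDefect_srcH` — twin of `…V12EndDoorsWB.stub_vl_nestedFramed_of_gluedWindowDefect_keyedAt_lev_wf2`;
* `vl_towerDataW_WF2_of_HE1free_srcH`, `vl_nestedFramed_of_towerDataTSW_srcH` — the compositions of record;
* **`KLRegimeVolumeLimitV17F3_of_atoms (HE1free) (HOsc) (HUV)`** — the child `…Theses.KLProgramme.KLRegimeVolumeLimitV17F3` BY NAME from the three atoms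
  (`stub_vl_HE1free`'s text, the (K5′) export, the UV levels), via `volumeLimitTextV17F3_of_framedNestedFlowText`.
Quantifier threading over landed theorems; nothing asserts the atoms, K3 or superconductivity. [cite: BenfattoGiulianiMastropietro2006, §2.7–§2.9, §3]
-/

noncomputable section

open Finset Filter Topology Complex Literature.MathematicalPhysics.QuantumLattice Literature.Probability.LatticeModels GrassmannAlgebra
open Summit.HubbardSuperconductivity.HubbardSuperconductivity.Theorems.EngineV8
open Summit.HubbardSuperconductivity.HubbardSuperconductivity.Theorems.KLProgrammeLegKernels
open Summit.HubbardSuperconductivity.HubbardSuperconductivity.Theorems.KLRegimeSplit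
open Summit.HubbardSuperconductivity.HubbardSuperconductivity.Theorems.TwoPointAssembly
open Summit.HubbardSuperconductivity.HubbardSuperconductivity.Theorems.TwoVolumeDefect
open Summit.HubbardSuperconductivity.HubbardSuperconductivity.Theorems.TwoVolumeSource
open Summit.HubbardSuperconductivity.HubbardSuperconductivity.Theorems.TorusFourierL2

set_option linter.dupNamespace false -- summit = problem name (single-conjunct summit), D-0017

namespace Summit.HubbardSuperconductivity.HubbardSuperconductivity.Theorems.TwoVolumeSource

/-- **`stub_vl_towerData` (v12W) under `R.WF2` from the atoms and the HISTORY-BOUND producer text** — twin of `stub_vl_towerDataW_WF2_of_atomsB_free` with the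
producer read at `(G, P, Q, R)` under the tower hypothesis. [folklore: quantifier threading; cite: BenfattoGiulianiMastropietro2006, §2.7-§2.9 and §3] -/
theorem vl_towerDataW_WF2_of_atomsB_srcH
    (Hcov : ∀ (G : GeoConsts) (P : SplitConsts) (Q : EngConsts) (R : RenConsts), G.WF → P.WF → Q.WF → R.WF2 →
      ∃ k₁ a₁ s₁ e₁ w₁ ρ : ℝ, 0 < k₁ ∧ 0 < a₁ ∧ 0 ≤ s₁ ∧ 0 ≤ e₁ ∧ 1 ≤ w₁ ∧ 0 < ρ ∧
        ∃ c₇ : ℝ, 0 < c₇ ∧ ∀ c : ℝ, 0 < c → c ≤ c₇ → ∃ U₇ : ℝ, 0 < U₇ ∧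
          ∀ μ ∈ klWindowC, ∀ U : ℝ, 0 < U → U ≤ U₇ → ∀ β : ℝ, klBetaMin ≤ β → β ≤ Real.exp (c / U ^ 2) →
            ∀ (K : TrigPolyC4v) (Lstar : ℕ) (Mstar : ℕ → ℕ), TowerP klPredsV17F2 G P Q R β U μ K Lstar Mstar →
            ∀ Λ : ℝ, 0 ≤ Λ → Λ ≤ klScale klE0 (nScales β + 1) → Λ * (4 : ℝ) ^ (nScales β + 1) ≤ ρ →
            ∃ L₂ : ℕ, ∃ M₂ : ℕ → ℕ → ℕ, ∀ (L b M : ℕ) [NeZero L] [NeZero (b * L)] [NeZero M], L₂ ≤ L → M₂ L b ≤ M →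
              (∀ j, j < nScales β → ScaleCovData (klStepCov L M β μ (klFlowFrameU L M β U μ (nScales β + 1)) j) Λ (Real.sqrt (k₁ ^ 2 * ((8 : ℝ) ^ j)⁻¹))
                (a₁ * (4 : ℝ) ^ j / imagTimeWeight β M) s₁) ∧
              (∀ j, j < nScales β → ScaleCovData (klStepCov (b * L) M β μ (klFlowFrameU (b * L) M β U μ (nScales β + 1)) j) Λ (Real.sqrt (k₁ ^ 2 * ((8 : ℝ) ^ j)⁻¹))
                (a₁ * (4 : ℝ) ^ j / imagTimeWeight β M) s₁) ∧
              (∀ j, j < nScales β → ScaleCovData (klStepCov (b * L) M β μ (klFlowFrameU L M β U μ (nScales β + 1)) j) Λ (Real.sqrt (k₁ ^ 2 * ((8 : ℝ) ^ j)⁻¹))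
                (a₁ * (4 : ℝ) ^ j / imagTimeWeight β M) s₁) ∧
              (∀ j, j < nScales β → ScaleCovSecData (klStepCov (b * L) M β μ (klFlowFrameU L M β U μ (nScales β + 1)) j) Λ e₁) ∧
              (∀ j, j ≤ nScales β → TransferWtData (klTowerTransfer (b * L) M β μ (klFlowFrameU L M β U μ (nScales β + 1)) j)
                (klBlockEquivD L b M j) (klBlockEquivD L b M (j - 1)) Λ w₁))
    (HE1 : ∀ (P : SplitConsts) (R : RenConsts), P.WF → R.WF2 →
      ∃ Q₁ : EngConsts, 0 ≤ Q₁.CE ∧ ∃ C₀ : ℝ, 0 ≤ C₀ ∧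
        ∃ c₇ : ℝ, 0 < c₇ ∧ ∀ c : ℝ, 0 < c → c ≤ c₇ → ∃ U₇ : ℝ, 0 < U₇ ∧
          ∀ μ ∈ klWindowC, ∀ U : ℝ, 0 < U → U ≤ U₇ → ∀ β : ℝ, klBetaMin ≤ β → β ≤ Real.exp (c / U ^ 2) →
            ∃ S₀ : ℕ → ℕ → ℝ, (∀ j m, 0 ≤ S₀ j m) ∧ (∀ j, j ≤ nScales β → ∀ m, 1 ≤ m → S₀ j (2 * m) ≤ C₀ * klWtBudget P Q₁ U (j + 1) (2 * m)) ∧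
            ∃ L₂ : ℕ, ∃ M₂ : ℕ → ℕ, ∀ (L M : ℕ) [NeZero L] [NeZero M], L₂ ≤ L → M₂ L ≤ M →
              (∀ k, k ≤ nScales β → hubbardEffPartitionFnCT L M β U μ 0 (klFlowFrameU L M β U μ (nScales β + 1)) (klScale klE0 (k + 1)) ≠ 0) ∧
              (∀ j, j ≤ nScales β → ∀ (m : ℕ) (q : Fin m) (w : SpaceTimeIdx L M × SectorLeg (sectorCount j)),
                klWtPinnedSumAt L M β μ (klFlowFrameU L M β U μ (nScales β + 1)) j j m (klEffectiveAction L M β U μ (klFlowFrameU L M β U μ (nScales β + 1)) klE0 (j + 1)) q w ≤ S₀ j m))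
    (Hmis : ∀ (G : GeoConsts) (P : SplitConsts) (Q : EngConsts) (R : RenConsts), G.WF → P.WF → Q.WF → R.WF2 →
        ∃ c₇ : ℝ, 0 < c₇ ∧ ∀ c : ℝ, 0 < c → c ≤ c₇ → ∃ U₇ : ℝ, 0 < U₇ ∧
          ∀ μ ∈ klWindowC, ∀ U : ℝ, 0 < U → U ≤ U₇ → ∀ β : ℝ, klBetaMin ≤ β → β ≤ Real.exp (c / U ^ 2) →
            ∀ (K : TrigPolyC4v) (Lstar : ℕ) (Mstar : ℕ → ℕ), TowerP klPredsV17F2 G P Q R β U μ K Lstar Mstar →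
            ∃ (sE cR cC δ : ℕ → ℕ → ℝ),
              (∀ j L, 0 ≤ sE j L ∧ 0 ≤ cR j L ∧ 0 ≤ cC j L ∧ 0 ≤ δ j L ∧ cR j L ≤ 1 ∧ cC j L ≤ 1 ∧ δ j L ≤ 1) ∧
              (∀ j, Tendsto (sE j) atTop (𝓝 0) ∧ Tendsto (cR j) atTop (𝓝 0) ∧ Tendsto (cC j) atTop (𝓝 0) ∧ Tendsto (δ j) atTop (𝓝 0)) ∧
            ∃ L₂ : ℕ, ∃ M₂ : ℕ → ℕ → ℕ, ∀ (L b M : ℕ) [NeZero L] [NeZero (b * L)] [NeZero M], L₂ ≤ L → M₂ L b ≤ M →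
              (∀ j, j < nScales β → ∀ x y, ‖(klStepCov (b * L) M β μ (klFlowFrameU (b * L) M β U μ (nScales β + 1)) j - klStepCov (b * L) M β μ (klFlowFrameU L M β U μ (nScales β + 1)) j) x y‖ ≤ sE j L) ∧
              (∀ j, j < nScales β → ∀ x, ∑ y, ‖(klStepCov (b * L) M β μ (klFlowFrameU (b * L) M β U μ (nScales β + 1)) j - klStepCov (b * L) M β μ (klFlowFrameU L M β U μ (nScales β + 1)) j) x y‖ ≤
                cR j L / imagTimeWeight β M) ∧
              (∀ j, j < nScales β → ∀ y, ∑ x, ‖(klStepCov (b * L) M β μ (klFlowFrameU (b * L) M β U μ (nScales β + 1)) j - klStepCov (b * L) M β μ (klFlowFrameU L M β U μ (nScales β + 1)) j) x y‖ ≤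
                cC j L / imagTimeWeight β M) ∧
              (∀ j, j ≤ nScales β → ∀ x, ∑ y, ‖klTowerTransfer (b * L) M β μ (klFlowFrameU (b * L) M β U μ (nScales β + 1)) j x y - klTowerTransfer (b * L) M β μ (klFlowFrameU L M β U μ (nScales β + 1)) j x y‖ ≤ δ j L) ∧
              (∀ j, j ≤ nScales β → ∀ y, ∑ x, ‖klTowerTransfer (b * L) M β μ (klFlowFrameU (b * L) M β U μ (nScales β + 1)) j x y - klTowerTransfer (b * L) M β μ (klFlowFrameU L M β U μ (nScales β + 1)) j x y‖ ≤ δ j L))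
    (HB1W : ∀ (G : GeoConsts) (P : SplitConsts) (Q : EngConsts) (R : RenConsts), G.WF → P.WF → Q.WF → R.WF2 →
        ∃ c₇ : ℝ, 0 < c₇ ∧ ∀ c : ℝ, 0 < c → c ≤ c₇ → ∃ U₇ : ℝ, 0 < U₇ ∧
          ∀ μ ∈ klWindowC, ∀ U : ℝ, 0 < U → U ≤ U₇ → ∀ β : ℝ, klBetaMin ≤ β → β ≤ Real.exp (c / U ^ 2) →
            ∀ (K : TrigPolyC4v) (Lstar : ℕ) (Mstar : ℕ → ℕ), TowerP klPredsV17F2 G P Q R β U μ K Lstar Mstar →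
            ∃ M₂ : ℕ → ℕ → ℕ, ∀ (k : ℕ) (η : ℝ), 0 < η → ∃ L₂ : ℕ, ∀ (L b M : ℕ) [NeZero L] [NeZero (b * L)] [NeZero M], L₂ ≤ L → M₂ L b ≤ M →
              ∀ (p : Fin k) (w : SrcLabel (b * L) M 0),
                (∀ i, 2 * (L / (4 * nScales β + 7)) ≤ (w.1.1.2 i).val % L ∧ (w.1.1.2 i).val % L + 2 * (L / (4 * nScales β + 7)) < L) →
                klKeyedDefectTSW L b M β U μ (klFlowFrameU L M β U μ (nScales β + 1)) (klFlowFrameU (b * L) M β U μ (nScales β + 1)) 1 0 k p w ≤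
                  imagTimeWeight β M * η)
    (hSrc : ∀ (G : GeoConsts) (P : SplitConsts) (Q : EngConsts) (R : RenConsts), P.WF → R.WF2 →
      ∃ Q' : EngConsts, 0 ≤ Q'.CE ∧ ∃ c₀ : ℝ, 0 < c₀ ∧ ∀ c : ℝ, 0 < c → c ≤ c₀ → ∃ U₀ : ℝ, 0 < U₀ ∧
        ∀ μ ∈ klWindowC, ∀ U : ℝ, 0 < U → U ≤ U₀ → ∀ β : ℝ, klBetaMin ≤ β → β ≤ Real.exp (c / U ^ 2) →
          ∀ (K : TrigPolyC4v) (Lstar : ℕ) (Mstar : ℕ → ℕ), TowerP klPredsV17F2 G P Q R β U μ K Lstar Mstar →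
          ∃ A : ℕ → ℕ → ℝ, (∀ j s, 0 ≤ A j s) ∧ ∃ L₁ : ℕ, ∃ M₁ : ℕ → ℕ, ∀ (L M : ℕ) [NeZero L] [NeZero M], L₁ ≤ L → M₁ L ≤ M →
            ∀ j : ℕ, j + 1 ≤ nScales β + 1 →
              SourceProfilesAtLev L M (klSrcBudget P Q' U A (j + 1)) β U μ (klFlowFrameU L M β U μ (nScales β + 1)) j j (j + 1))
    (G : GeoConsts) (P : SplitConsts) (Q : EngConsts) (R : RenConsts) (hG : G.WF) (hP : P.WF) (hQ : Q.WF) (hR2 : R.WF2) :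
    ∃ c₅ : ℝ, 0 < c₅ ∧ ∀ c : ℝ, 0 < c → c ≤ c₅ → ∃ U₀ : ℝ, 0 < U₀ ∧
      ∀ μ ∈ klWindowC, ∀ U : ℝ, 0 < U → U ≤ U₀ → ∀ β : ℝ, klBetaMin ≤ β → β ≤ Real.exp (c / U ^ 2) →
        ∀ K : TrigPolyC4v, klPredsV17F2.frameOK R U (nScales β) μ K →
          ∀ (Lstar : ℕ) (Mstar : ℕ → ℕ), TowerP klPredsV17F2 G P Q R β U μ K Lstar Mstar →
            ∃ t : ℝ, 0 < t ∧ t ≤ 1 ∧ Nonempty (TowerDataTSW β U μ t) := by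
  -- the history-bound producer text at `(G, P, Q, R)`
  obtain ⟨Q', hQ'CE, c₀, hc₀, hS⟩ := hSrc G P Q R hP hR2
  have hKl : 0 < P.Klam := lt_of_lt_of_le one_pos hP.1
  have hKl0 : 0 ≤ P.Klam := hKl.le
  -- the body of `hSup` at `(G, P, Q, R, Q')` from the atoms, and the `ε`-doors
  obtain ⟨k₀, B₂, B₃, W, hk₀, hB₂, hB₃, hW, c₆, hc₆, hsup⟩ := hSupRegBody_of_atomsBW_free Hcov HE1 Hmis HB1W G P Q R Q' hG hP hQ hR2 hQ'CE
  obtain ⟨c₅, hc₅, U₅, hU₅, hdoors⟩ := exists_doors_towerEps hKl hB₂ hB₃ hW hk₀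
  refine ⟨min (min c₅ c₀) c₆, lt_min (lt_min hc₅ hc₀) hc₆, fun c hc0 hcc => ?_⟩
  have hcc₅ : c ≤ c₅ := hcc.trans ((min_le_left _ _).trans (min_le_left _ _))
  have hcc₀ : c ≤ c₀ := hcc.trans ((min_le_left _ _).trans (min_le_right _ _))
  have hcc₆ : c ≤ c₆ := hcc.trans (min_le_right _ _)
  obtain ⟨U₀, hU₀, hS2⟩ := hS c hc0 hcc₀
  obtain ⟨U₆, hU₆, hsup2⟩ := hsup c hc0 hcc₆
  refine ⟨min (min U₅ U₀) U₆, lt_min (lt_min hU₅ hU₀) hU₆, fun μ hμ U hU0 hUU β hβmin hβmax K hK Lstar Mstar hT => ?_⟩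
  have hUU₅ : U ≤ U₅ := hUU.trans ((min_le_left _ _).trans (min_le_left _ _))
  have hUU₀ : U ≤ U₀ := hUU.trans ((min_le_left _ _).trans (min_le_right _ _))
  have hUU₆ : U ≤ U₆ := hUU.trans (min_le_right _ _)
  obtain ⟨A, -, L₁, M₁, hA⟩ := hS2 μ hμ U hU0 hUU₀ β hβmin hβmax K Lstar Mstar hT
  have hUabs : |U| ≤ U₅ := by rw [abs_of_pos hU0]; exact hUU₅
  refine hsup2 μ hμ U hU0 hUU₆ β hβmin hβmax K hK Lstar Mstar hT (fun j hj => hdoors c hc0.le hcc₅ U hU0.ne' hUabs β hβmin hβmax j hj)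
    (fun j s => max (A j s) 0) L₁ M₁ (fun j s => le_max_right _ _) ?_
  intro L M _ _ hL hM j hj
  exact (hA L M hL hM j hj).mono fun s m => klSrcBudget_mono_A P Q' U hQ'CE hKl0 (fun j s => le_max_left _ _) (j + 1) s m

/-- **`stub_vl_towerData` (v12W) from `HE1free` and the history-bound producer text** (`Hcov` := `hcov_of_towerP`, `Hmis` := `hmis_of_covMis hmisCov_of_towerP`,
`HB1W` := `hB1W_of_towerV17F2`). [folklore: composition; cite: BenfattoGiulianiMastropietro2006, §2.7-§2.9 and §3] -/
theorem vl_towerDataW_WF2_of_HE1free_srcH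
    (HE1free : ∀ (P : SplitConsts) (R : RenConsts), P.WF → R.WF2 →
      ∃ Q₁ : EngConsts, 0 ≤ Q₁.CE ∧ ∃ C₀ : ℝ, 0 ≤ C₀ ∧
        ∃ c₇ : ℝ, 0 < c₇ ∧ ∀ c : ℝ, 0 < c → c ≤ c₇ → ∃ U₇ : ℝ, 0 < U₇ ∧
          ∀ μ ∈ klWindowC, ∀ U : ℝ, 0 < U → U ≤ U₇ → ∀ β : ℝ, klBetaMin ≤ β → β ≤ Real.exp (c / U ^ 2) →
            ∃ S₀ : ℕ → ℕ → ℝ, (∀ j m, 0 ≤ S₀ j m) ∧ (∀ j, j ≤ nScales β → ∀ m, 1 ≤ m → S₀ j (2 * m) ≤ C₀ * klWtBudget P Q₁ U (j + 1) (2 * m)) ∧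
            ∃ L₂ : ℕ, ∃ M₂ : ℕ → ℕ, ∀ (L M : ℕ) [NeZero L] [NeZero M], L₂ ≤ L → M₂ L ≤ M →
              (∀ k, k ≤ nScales β → hubbardEffPartitionFnCT L M β U μ 0 (klFlowFrameU L M β U μ (nScales β + 1)) (klScale klE0 (k + 1)) ≠ 0) ∧
              (∀ j, j ≤ nScales β → ∀ (m : ℕ) (q : Fin m) (w : SpaceTimeIdx L M × SectorLeg (sectorCount j)),
                klWtPinnedSumAt L M β μ (klFlowFrameU L M β U μ (nScales β + 1)) j j m (klEffectiveAction L M β U μ (klFlowFrameU L M β U μ (nScales β + 1)) klE0 (j + 1)) q w ≤ S₀ j m))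
    (hSrc : ∀ (G : GeoConsts) (P : SplitConsts) (Q : EngConsts) (R : RenConsts), P.WF → R.WF2 →
      ∃ Q' : EngConsts, 0 ≤ Q'.CE ∧ ∃ c₀ : ℝ, 0 < c₀ ∧ ∀ c : ℝ, 0 < c → c ≤ c₀ → ∃ U₀ : ℝ, 0 < U₀ ∧
        ∀ μ ∈ klWindowC, ∀ U : ℝ, 0 < U → U ≤ U₀ → ∀ β : ℝ, klBetaMin ≤ β → β ≤ Real.exp (c / U ^ 2) →
          ∀ (K : TrigPolyC4v) (Lstar : ℕ) (Mstar : ℕ → ℕ), TowerP klPredsV17F2 G P Q R β U μ K Lstar Mstar →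
          ∃ A : ℕ → ℕ → ℝ, (∀ j s, 0 ≤ A j s) ∧ ∃ L₁ : ℕ, ∃ M₁ : ℕ → ℕ, ∀ (L M : ℕ) [NeZero L] [NeZero M], L₁ ≤ L → M₁ L ≤ M →
            ∀ j : ℕ, j + 1 ≤ nScales β + 1 →
              SourceProfilesAtLev L M (klSrcBudget P Q' U A (j + 1)) β U μ (klFlowFrameU L M β U μ (nScales β + 1)) j j (j + 1))
    (G : GeoConsts) (P : SplitConsts) (Q : EngConsts) (R : RenConsts) (hG : G.WF) (hP : P.WF) (hQ : Q.WF) (hR2 : R.WF2) :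
    ∃ c₅ : ℝ, 0 < c₅ ∧ ∀ c : ℝ, 0 < c → c ≤ c₅ → ∃ U₀ : ℝ, 0 < U₀ ∧
      ∀ μ ∈ klWindowC, ∀ U : ℝ, 0 < U → U ≤ U₀ → ∀ β : ℝ, klBetaMin ≤ β → β ≤ Real.exp (c / U ^ 2) →
        ∀ K : TrigPolyC4v, klPredsV17F2.frameOK R U (nScales β) μ K →
          ∀ (Lstar : ℕ) (Mstar : ℕ → ℕ), TowerP klPredsV17F2 G P Q R β U μ K Lstar Mstar →
            ∃ t : ℝ, 0 < t ∧ t ≤ 1 ∧ Nonempty (TowerDataTSW β U μ t) :=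
  vl_towerDataW_WF2_of_atomsB_srcH (fun G P Q R hG hP hQ hR2 => hcov_of_towerP G P Q R hG hP hQ hR2) HE1free
    (fun G P Q R hG hP hQ hR2 => hmis_of_covMis (fun G P Q R hG hP hQ hR2 => hmisCov_of_towerP G P Q R hG hP hQ hR2) G P Q R hG hP hQ hR2)
    (fun G P Q R hG hP hQ hR2 => hB1W_of_towerV17F2 G P Q R hG hP hQ hR2) hSrc G P Q R hG hP hQ hR2

end Summit.HubbardSuperconductivity.HubbardSuperconductivity.Theorems.TwoVolumeSource

namespace Summit.HubbardSuperconductivity.HubbardSuperconductivity.Theorems.TwoPointAssembly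

/-- **The window-keyed end chain closes `stub_vl_nestedFramed` from the HISTORY-BOUND producer text** — twin of
`stub_vl_nestedFramed_of_gluedWindowDefect_keyedAt_lev_wf2` with token #24 read at `(G, P, Q, R)` under the tower hypothesis. [cite: BenfattoGiulianiMastropietro2006, §2.9 (4.3)-(4.6)] -/
theorem vl_nestedFramed_of_gluedWindowDefect_srcH
    (hGlued : ∀ (G : GeoConsts) (P : SplitConsts) (Q : EngConsts) (R : RenConsts), G.WF → P.WF → Q.WF → R.WF2 →
      ∃ c₅ : ℝ, 0 < c₅ ∧ ∀ c : ℝ, 0 < c → c ≤ c₅ → ∃ U₀ : ℝ, 0 < U₀ ∧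
        ∀ μ ∈ klWindowC, ∀ U : ℝ, 0 < U → U ≤ U₀ → ∀ β : ℝ, klBetaMin ≤ β → β ≤ Real.exp (c / U ^ 2) →
          ∀ K : TrigPolyC4v, klPredsV17F2.frameOK R U (nScales β) μ K →
            ∀ (Lstar : ℕ) (Mstar : ℕ → ℕ), TowerP klPredsV17F2 G P Q R β U μ K Lstar Mstar →
              ∃ L₀ : ℕ, ∃ δ : ℕ → ℝ, Tendsto δ atTop (𝓝 0) ∧ ∃ Rd : ℕ → ℕ, Tendsto Rd atTop atTop ∧
                ∀ (L : ℕ) [NeZero L], L₀ ≤ L → ∀ (L'' : ℕ) [NeZero L''] (b : ℕ), L'' = b * L → ∃ M₀ : ℕ, ∀ (M : ℕ) [NeZero M], M₀ ≤ M →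
                  ∃ (J : ℕ) (e : (SpaceTimeIdx L'' M × SectorLeg (sectorCount J)) ≃ (Fin 2 → Fin b) × (SpaceTimeIdx L M × SectorLeg (sectorCount J)))
                    (ed : SrcLabel L'' M J ≃ (Fin 2 → Fin b) × SrcLabel L M J),
                    (∀ X' i, ((e X').1 i : ℕ) = (X'.1.2 i).val / L) ∧
                    (∀ X', (e X').2 = ((X'.1.1, fun i => (((X'.1.2 i).val : ℕ) : ZMod L)), X'.2)) ∧
                    (∀ x s, ed (x, s) = ((e x).1, ((e x).2, s))) ∧
                  ∃ of : SpaceTimeIdx L'' M, (∀ j, Rd L ≤ (of.2 j).val % L ∧ (of.2 j).val % L + Rd L < L) ∧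
                    2 * (imagTimeWeight β M)⁻¹ *
                      (∑ X ∈ univ.filter (fun X : Fin 2 → SrcLabel L'' M J => X 0 = ((of, ((⟨0, sectorCount_pos _⟩, 0), 0)), 1) ∧ (X 1).2 = 1),
                        ‖kernel ℂ (srcTrunc ℂ (fun Y : SrcLabel L'' M J => Y.2 = 1) 3
                              (ExteriorAlgebra.map (Matrix.toLin' (((imagTimeWeight β M : ℝ) : ℂ) •
                                  klSrcAnalysisAtW L'' M β μ (klFlowFrameU L'' M β U μ (nScales β + 1)) J))
                                (klEffectiveAction L'' M β U μ (klFlowFrameU L'' M β U μ (nScales β + 1)) klE0 (nScales β + 1)))) 2 X -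
                            (if ∀ i, (ed (X i)).1 = (ed (X 0)).1 then
                              kernel ℂ (srcTrunc ℂ (fun Y : SrcLabel L M J => Y.2 = 1) 3
                                (ExteriorAlgebra.map (Matrix.toLin' (((imagTimeWeight β M : ℝ) : ℂ) •
                                    klSrcAnalysisAtW L M β μ (klFlowFrameU L M β U μ (nScales β + 1)) J))
                                  (klEffectiveAction L M β U μ (klFlowFrameU L M β U μ (nScales β + 1)) klE0 (nScales β + 1)))) 2
                                (fun i => (ed (X i)).2)
                            else 0)‖) ≤ δ L) :
    (∀ (G : GeoConsts) (P : SplitConsts) (Q : EngConsts) (R : RenConsts), P.WF → R.WF2 →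
      ∃ Q' : EngConsts, 0 ≤ Q'.CE ∧ ∃ c₀ : ℝ, 0 < c₀ ∧ ∀ c : ℝ, 0 < c → c ≤ c₀ → ∃ U₀ : ℝ, 0 < U₀ ∧
        ∀ μ ∈ klWindowC, ∀ U : ℝ, 0 < U → U ≤ U₀ → ∀ β : ℝ, klBetaMin ≤ β → β ≤ Real.exp (c / U ^ 2) →
          ∀ (K : TrigPolyC4v) (Lstar : ℕ) (Mstar : ℕ → ℕ), TowerP klPredsV17F2 G P Q R β U μ K Lstar Mstar →
          ∃ A : ℕ → ℕ → ℝ, (∀ j s, 0 ≤ A j s) ∧ ∃ L₁ : ℕ, ∃ M₁ : ℕ → ℕ, ∀ (L M : ℕ) [NeZero L] [NeZero M], L₁ ≤ L → M₁ L ≤ M →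
            ∀ j : ℕ, j + 1 ≤ nScales β + 1 →
              SourceProfilesAtLev L M (klSrcBudget P Q' U A (j + 1)) β U μ (klFlowFrameU L M β U μ (nScales β + 1)) j j (j + 1)) →
    ∀ (G : GeoConsts) (P : SplitConsts) (Q : EngConsts) (R : RenConsts), G.WF → P.WF → Q.WF → R.WF2 →
      ∃ c₅ : ℝ, 0 < c₅ ∧ ∀ c : ℝ, 0 < c → c ≤ c₅ → ∃ U₀ : ℝ, 0 < U₀ ∧
        ∀ μ ∈ klWindowC, ∀ U : ℝ, 0 < U → U ≤ U₀ → ∀ β : ℝ, klBetaMin ≤ β → β ≤ Real.exp (c / U ^ 2) →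
          ∀ K : TrigPolyC4v, klPredsV17F2.frameOK R U (nScales β) μ K →
            ∀ (Lstar : ℕ) (Mstar : ℕ → ℕ), TowerP klPredsV17F2 G P Q R β U μ K Lstar Mstar →
              ∀ n : ℤ, ∃ L₀ : ℕ, ∃ ρ : ℕ → ℝ, Tendsto ρ atTop (𝓝 0) ∧
                ∀ (L : ℕ) [NeZero L], L₀ ≤ L → ∀ (L'' : ℕ) [NeZero L''], L ∣ L'' → ∃ M₀ : ℕ, ∀ (M : ℕ) [NeZero M], M₀ ≤ M →
                  ∀ (ω : MatsubaraIdx M), matsubaraInt M ω = n → ∀ (k : TorusSite 2 L) (k'' : TorusSite 2 L''),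
                    latticeMomentum L'' k'' = latticeMomentum L k →
                      ‖klSelfEnergy L M β U μ (klFlowFrameU L M β U μ (nScales β + 1)) klE0 (nScales β + 1) (ω, k) 0 -
                          klSelfEnergy L'' M β U μ (klFlowFrameU L'' M β U μ (nScales β + 1)) klE0 (nScales β + 1) (ω, k'') 0‖ ≤ ρ L := by
  intro hSrc
  classical
  -- the (N2) constant, once
  obtain ⟨C, -, hC⟩ := exists_windowedWeightedRows_le
  -- token #24 at `(G, P, Q, R)`, history-bound; thresholds shared by `min` / `max`
  refine framedNestedFlowTextV17F2_of_windowGluedPosDefect_weightedRows_wf2 ?_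
  intro G P Q R hG hP hQ hR
  obtain ⟨Q'', -, c₀', hc₀', hS'⟩ := hSrc G P Q R hP hR
  obtain ⟨c₅, hc₅, hN⟩ := hGlued G P Q R hG hP hQ hR
  refine ⟨min c₅ c₀', lt_min hc₅ hc₀', fun c hc0 hcc => ?_⟩
  obtain ⟨U₁, hU₁, hN1⟩ := hN c hc0 (hcc.trans (min_le_left _ _))
  obtain ⟨U₂, hU₂, hS2⟩ := hS' c hc0 (hcc.trans (min_le_right _ _))
  refine ⟨min U₁ U₂, lt_min hU₁ hU₂, fun μ hμ U hU0 hUU β hβmin hβmax K hK Lstar Mstar hT => ?_⟩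
  have hβ : 0 < β := KLRegimeSplit.pos_of_klBetaMin_le hβmin
  obtain ⟨L₀, δ, hδ, Rd, hRd, hLn⟩ := hN1 μ hμ U hU0 (hUU.trans (min_le_left _ _)) β hβmin hβmax K hK Lstar Mstar hT
  obtain ⟨A, -, L₁, M₁, hA⟩ := hS2 μ hμ U hU0 (hUU.trans (min_le_right _ _)) β hβmin hβmax K Lstar Mstar hT
  refine ⟨max L₀ L₁, δ, C * A (nScales β + 1) 2, hδ, Rd, hRd, fun L _ hL L'' _ b hb => ?_⟩
  obtain ⟨M₀, hM₀⟩ := hLn L ((le_max_left _ _).trans hL) L'' b hb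
  have hLL'' : L ≤ L'' := Nat.le_of_dvd (Nat.pos_of_ne_zero (NeZero.ne L'')) ⟨b, by rw [hb, mul_comm]⟩
  have hL₁ : L₁ ≤ L := (le_max_right _ _).trans hL
  have hL₁'' : L₁ ≤ L'' := hL₁.trans hLL''
  refine ⟨max M₀ (max (M₁ L) (M₁ L'')), fun M _ hM => ?_⟩
  obtain ⟨J, e, ed, he1, he2, hed, of, hof, hglued⟩ := hM₀ M ((le_max_left _ _).trans hM)
  have hML : M₁ L ≤ M := (le_max_left _ _).trans ((le_max_right _ _).trans hM)
  have hML'' : M₁ L'' ≤ M := (le_max_right _ _).trans ((le_max_right _ _).trans hM)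
  -- token #24 at every slot-`0` source pin of both volumes
  have hAf : ∀ o : SpaceTimeIdx L'' M, klSrcPinnedSum L'' M β U μ (klFlowFrameU L'' M β U μ (nScales β + 1)) (nScales β + 1) 2 2 0
      ((o, ((⟨0, sectorCount_pos _⟩, 0), 0)), 1) ≤ A (nScales β + 1) 2 := fun o =>
    klSrcPinnedSum_two_two_le_of_sourceProfilesAtLev hβ.le (Nat.le_succ _) (hA L'' M hL₁'' hML'' (nScales β) le_rfl) o 0 0
  have hAc : ∀ o : SpaceTimeIdx L M, klSrcPinnedSum L M β U μ (klFlowFrameU L M β U μ (nScales β + 1)) (nScales β + 1) 2 2 0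
      ((o, ((⟨0, sectorCount_pos _⟩, 0), 0)), 1) ≤ A (nScales β + 1) 2 := fun o =>
    klSrcPinnedSum_two_two_le_of_sourceProfilesAtLev hβ.le (Nat.le_succ _) (hA L M hL₁ hML (nScales β) le_rfl) o 0 0
  refine ⟨of, hof, ?_, hC L'' M β hβ U μ _ (nScales β + 1) of _ (fun τ => hAf (τ, of.2)),
    hC L M β hβ U μ _ (nScales β + 1) (of.1, fun i => (((of.2 i).val : ℕ) : ZMod L)) _ (fun τ => hAc (τ, _))⟩
  -- the glued position-space defect is (a sub-sum of) the keyed defect: names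
  set ε : ℝ := imagTimeWeight β M with hε_def
  set Kc := klFlowFrameU L M β U μ (nScales β + 1) with hKc
  set Kf := klFlowFrameU L'' M β U μ (nScales β + 1) with hKf
  set Af := srcTrunc ℂ (fun Y : SrcLabel L'' M J => Y.2 = 1) 3
    (ExteriorAlgebra.map (Matrix.toLin' (((ε : ℝ) : ℂ) • klSrcAnalysisAtW L'' M β μ Kf J))
      (klEffectiveAction L'' M β U μ Kf klE0 (nScales β + 1))) with hAf_def
  set Ac := srcTrunc ℂ (fun Y : SrcLabel L M J => Y.2 = 1) 3
    (ExteriorAlgebra.map (Matrix.toLin' (((ε : ℝ) : ℂ) • klSrcAnalysisAtW L M β μ Kc J))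
      (klEffectiveAction L M β U μ Kc klE0 (nScales β + 1))) with hAc_def
  set Wf := sectorisedKernel L'' M β (srcWindowFamily L'' M) (klEffectiveAction L'' M β U μ Kf klE0 (nScales β + 1)) 2
    (![((0, 0), 0), ((0, 0), 1)] : Fin 2 → SectorLeg 1) with hWf_def
  set Wc := sectorisedKernel L M β (srcWindowFamily L M) (klEffectiveAction L M β U μ Kc klE0 (nScales β + 1)) 2
    (![((0, 0), 0), ((0, 0), 1)] : Fin 2 → SectorLeg 1) with hWc_def
  set sP : SectorLeg (sectorCount J) := ((⟨0, sectorCount_pos J⟩, 0), 0) with hsP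
  set sM : SectorLeg (sectorCount J) := ((⟨0, sectorCount_pos J⟩, 0), 1) with hsM
  have hMpos : (0 : ℝ) < M := Nat.cast_pos.2 (Nat.pos_of_ne_zero (NeZero.ne M))
  have hε : 0 < ε := by rw [hε_def]; unfold imagTimeWeight; positivity
  -- keyed ↦ e-free
  have hkey : ∀ X : Fin 2 → SrcLabel L'' M J,
      (if ∀ i, (ed (X i)).1 = (ed (X 0)).1 then kernel ℂ Ac 2 (fun i => (ed (X i)).2) else 0) =
      if ∀ i j, ((X i).1.1.2 j).val / L = ((X 0).1.1.2 j).val / L then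
          kernel ℂ Ac 2 (fun i => ((((X i).1.1.1, fun j => ((((X i).1.1.2 j).val : ℕ) : ZMod L)), (X i).1.2), (X i).2))
        else 0 := fun X => keyedReduced_eq_ite e ed he1 he2 hed _ 0 X
  simp only [hkey] at hglued
  -- the e-free summand and the source-pair strings
  let G : (Fin 2 → SrcLabel L'' M J) → ℝ := fun X =>
    ‖kernel ℂ Af 2 X - (if ∀ i j, ((X i).1.1.2 j).val / L = ((X 0).1.1.2 j).val / L then
        kernel ℂ Ac 2 (fun i => ((((X i).1.1.1, fun j => ((((X i).1.1.2 j).val : ℕ) : ZMod L)), (X i).1.2), (X i).2)) else 0)‖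
  let g : ImagTimeIdx M → TorusSite 2 L'' → ℝ := fun t₁ y =>
    ‖Wf ![of, (t₁, y)] - (if ∀ j, (y j).val / L = (of.2 j).val / L then
        Wc ![(of.1, fun i => (((of.2 i).val : ℕ) : ZMod L)), (t₁, fun i => (((y i).val : ℕ) : ZMod L))] else 0)‖
  let ψ : ImagTimeIdx M × TorusSite 2 L'' → (Fin 2 → SrcLabel L'' M J) := fun q => ![((of, sP), 1), (((q.1, q.2), sM), 1)]
  have hG0 : ∀ X, 0 ≤ G X := fun X => norm_nonneg _
  -- termwise: `G (ψ q) = ε² · g q`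
  have hterm : ∀ q : ImagTimeIdx M × TorusSite 2 L'', G (ψ q) = ε ^ 2 * g q.1 q.2 := by
    rintro ⟨t₁, y⟩
    have hf : kernel ℂ Af 2 (ψ (t₁, y)) = ((ε : ℝ) : ℂ) ^ 2 * Wf ![of, (t₁, y)] := by
      rw [hAf_def, hWf_def]
      exact kernel_srcTrunc_map_smul_klSrcAnalysisAtW_pair _ β U μ Kf J (nScales β + 1) of (t₁, y)
    have hres : (fun i => (((((ψ (t₁, y)) i).1.1.1, fun j => (((((ψ (t₁, y)) i).1.1.2 j).val : ℕ) : ZMod L)), ((ψ (t₁, y)) i).1.2),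
        ((ψ (t₁, y)) i).2) : Fin 2 → SrcLabel L M J) =
        ![(((of.1, fun i => (((of.2 i).val : ℕ) : ZMod L)), sP), 1), (((t₁, fun i => (((y i).val : ℕ) : ZMod L)), sM), 1)] := by
      funext i
      fin_cases i <;> rfl
    have hc : kernel ℂ Ac 2 ![(((of.1, fun i => (((of.2 i).val : ℕ) : ZMod L)), sP), 1), (((t₁, fun i => (((y i).val : ℕ) : ZMod L)), sM), 1)] =
        ((ε : ℝ) : ℂ) ^ 2 * Wc ![(of.1, fun i => (((of.2 i).val : ℕ) : ZMod L)), (t₁, fun i => (((y i).val : ℕ) : ZMod L))] := by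
      rw [hAc_def, hWc_def]
      exact kernel_srcTrunc_map_smul_klSrcAnalysisAtW_pair _ β U μ Kc J (nScales β + 1) _ _
    have htest : (∀ i j, (((ψ (t₁, y)) i).1.1.2 j).val / L = (((ψ (t₁, y)) 0).1.1.2 j).val / L) ↔ ∀ j, (y j).val / L = (of.2 j).val / L := by
      constructor
      · intro h j; exact h 1 j
      · intro h i j
        fin_cases i
        · rfl
        · exact h j
    have hnorm : ‖((ε : ℝ) : ℂ) ^ 2‖ = ε ^ 2 := by rw [norm_pow, Complex.norm_real, Real.norm_of_nonneg hε.le]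
    show ‖kernel ℂ Af 2 (ψ (t₁, y)) - _‖ = ε ^ 2 * ‖Wf ![of, (t₁, y)] - _‖
    rw [hf, hres, hc]
    by_cases h : ∀ j, (y j).val / L = (of.2 j).val / L
    · rw [if_pos (htest.2 h), if_pos h, ← mul_sub, norm_mul, hnorm]
    · rw [if_neg (fun h' => h (htest.1 h')), if_neg h, sub_zero, sub_zero, norm_mul, hnorm]
  -- the strings `ψ q` are distinct members of the keyed filter
  have hψinj : Function.Injective ψ := by
    intro q q' h
    have h1 : ((ψ q) 1).1.1 = ((ψ q') 1).1.1 := by rw [h]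
    exact Prod.ext (Prod.mk.inj h1).1 (Prod.mk.inj h1).2
  have hmem : ∀ q, ψ q ∈ univ.filter (fun X : Fin 2 → SrcLabel L'' M J => X 0 = ((of, sP), 1) ∧ (X 1).2 = 1) :=
    fun q => mem_filter.2 ⟨mem_univ _, rfl, rfl⟩
  have hsub : ε ^ 2 * (∑ t₁ : ImagTimeIdx M, ∑ y : TorusSite 2 L'', g t₁ y) ≤
      ∑ X ∈ univ.filter (fun X : Fin 2 → SrcLabel L'' M J => X 0 = ((of, sP), 1) ∧ (X 1).2 = 1), G X := by
    calc ε ^ 2 * (∑ t₁ : ImagTimeIdx M, ∑ y : TorusSite 2 L'', g t₁ y)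
        = ∑ q : ImagTimeIdx M × TorusSite 2 L'', ε ^ 2 * g q.1 q.2 := by
          rw [mul_sum, Fintype.sum_prod_type]
          simp only [mul_sum]
      _ = ∑ q : ImagTimeIdx M × TorusSite 2 L'', G (ψ q) := sum_congr rfl fun q _ => (hterm q).symm
      _ = ∑ X ∈ (univ : Finset (ImagTimeIdx M × TorusSite 2 L'')).image ψ, G X := (sum_image fun q _ q' _ h => hψinj h).symm
      _ ≤ _ := sum_le_sum_of_subset_of_nonneg (fun X hX => by
          obtain ⟨q, -, rfl⟩ := mem_image.1 hX; exact hmem q) fun X _ _ => hG0 X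
  -- assemble: `2ε·GLUED_pos = 2ε⁻¹·(ε²·GLUED_pos) ≤ 2ε⁻¹·KEYED ≤ δ L`
  calc 2 * ε * (∑ t₁ : ImagTimeIdx M, ∑ y : TorusSite 2 L'', g t₁ y)
      = 2 * ε⁻¹ * (ε ^ 2 * ∑ t₁ : ImagTimeIdx M, ∑ y : TorusSite 2 L'', g t₁ y) := two_mul_eps_eq _ _ hε.ne'
    _ ≤ 2 * ε⁻¹ * ∑ X ∈ univ.filter (fun X : Fin 2 → SrcLabel L'' M J => X 0 = ((of, sP), 1) ∧ (X 1).2 = 1), G X :=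
        mul_le_mul_of_nonneg_left hsub (by positivity)
    _ ≤ δ L := hglued

end Summit.HubbardSuperconductivity.HubbardSuperconductivity.Theorems.TwoPointAssembly

namespace Summit.HubbardSuperconductivity.HubbardSuperconductivity.Theorems.TwoVolumeSource

/-- **The truncated closer keyed to the history-bound producer** — twin of `stub_vl_nestedFramed_of_towerDataTSW_lev_wf2` (the data statement is taken
OUTRIGHT, the producer text history-bound). [folklore: composition; cite: BenfattoGiulianiMastropietro2006, §2.9 (4.3)-(4.8)] -/
theorem vl_nestedFramed_of_towerDataTSW_srcH
    (hSrc : (∀ (G : GeoConsts) (P : SplitConsts) (Q : EngConsts) (R : RenConsts), P.WF → R.WF2 →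
      ∃ Q' : EngConsts, 0 ≤ Q'.CE ∧ ∃ c₀ : ℝ, 0 < c₀ ∧ ∀ c : ℝ, 0 < c → c ≤ c₀ → ∃ U₀ : ℝ, 0 < U₀ ∧
        ∀ μ ∈ klWindowC, ∀ U : ℝ, 0 < U → U ≤ U₀ → ∀ β : ℝ, klBetaMin ≤ β → β ≤ Real.exp (c / U ^ 2) →
          ∀ (K : TrigPolyC4v) (Lstar : ℕ) (Mstar : ℕ → ℕ), TowerP klPredsV17F2 G P Q R β U μ K Lstar Mstar →
          ∃ A : ℕ → ℕ → ℝ, (∀ j s, 0 ≤ A j s) ∧ ∃ L₁ : ℕ, ∃ M₁ : ℕ → ℕ, ∀ (L M : ℕ) [NeZero L] [NeZero M], L₁ ≤ L → M₁ L ≤ M →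
            ∀ j : ℕ, j + 1 ≤ nScales β + 1 →
              SourceProfilesAtLev L M (klSrcBudget P Q' U A (j + 1)) β U μ (klFlowFrameU L M β U μ (nScales β + 1)) j j (j + 1)))
    (hT : ∀ (G : GeoConsts) (P : SplitConsts) (Q : EngConsts) (R : RenConsts), G.WF → P.WF → Q.WF → R.WF2 →
      ∃ c₅ : ℝ, 0 < c₅ ∧ ∀ c : ℝ, 0 < c → c ≤ c₅ → ∃ U₀ : ℝ, 0 < U₀ ∧
        ∀ μ ∈ klWindowC, ∀ U : ℝ, 0 < U → U ≤ U₀ → ∀ β : ℝ, klBetaMin ≤ β → β ≤ Real.exp (c / U ^ 2) →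
          ∀ K : TrigPolyC4v, klPredsV17F2.frameOK R U (nScales β) μ K →
            ∀ (Lstar : ℕ) (Mstar : ℕ → ℕ), TowerP klPredsV17F2 G P Q R β U μ K Lstar Mstar →
              ∃ t : ℝ, 0 < t ∧ t ≤ 1 ∧ Nonempty (TowerDataTSW β U μ t)) :
    ∀ (G : GeoConsts) (P : SplitConsts) (Q : EngConsts) (R : RenConsts), G.WF → P.WF → Q.WF → R.WF2 →
      ∃ c₅ : ℝ, 0 < c₅ ∧ ∀ c : ℝ, 0 < c → c ≤ c₅ → ∃ U₀ : ℝ, 0 < U₀ ∧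
        ∀ μ ∈ klWindowC, ∀ U : ℝ, 0 < U → U ≤ U₀ → ∀ β : ℝ, klBetaMin ≤ β → β ≤ Real.exp (c / U ^ 2) →
          ∀ K : TrigPolyC4v, klPredsV17F2.frameOK R U (nScales β) μ K →
            ∀ (Lstar : ℕ) (Mstar : ℕ → ℕ), TowerP klPredsV17F2 G P Q R β U μ K Lstar Mstar →
              ∀ n : ℤ, ∃ L₀ : ℕ, ∃ ρ : ℕ → ℝ, Tendsto ρ atTop (𝓝 0) ∧
                ∀ (L : ℕ) [NeZero L], L₀ ≤ L → ∀ (L'' : ℕ) [NeZero L''], L ∣ L'' → ∃ M₀ : ℕ, ∀ (M : ℕ) [NeZero M], M₀ ≤ M →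
                  ∀ (ω : MatsubaraIdx M), matsubaraInt M ω = n → ∀ (k : TorusSite 2 L) (k'' : TorusSite 2 L''),
                    latticeMomentum L'' k'' = latticeMomentum L k →
                      ‖klSelfEnergy L M β U μ (klFlowFrameU L M β U μ (nScales β + 1)) klE0 (nScales β + 1) (ω, k) 0 -
                          klSelfEnergy L'' M β U μ (klFlowFrameU L'' M β U μ (nScales β + 1)) klE0 (nScales β + 1) (ω, k'') 0‖ ≤ ρ L := by
  refine vl_nestedFramed_of_gluedWindowDefect_srcH (fun G P Q R hG hP hQ hR => ?_) hSrc
  obtain ⟨c₅, hc₅, hc⟩ := hT G P Q R hG hP hQ hR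
  refine ⟨c₅, hc₅, fun c hc0 hcc => ?_⟩
  obtain ⟨U₀, hU₀, hU⟩ := hc c hc0 hcc
  refine ⟨U₀, hU₀, fun μ hμ U hU0 hUU β hβmin hβmax K hK Lstar Mstar hTP => ?_⟩
  obtain ⟨t, ht0, ht1, ⟨D⟩⟩ := hU μ hμ U hU0 hUU β hβmin hβmax K hK Lstar Mstar hTP
  exact gluedInner_of_towerDataTSW β U μ (KLRegimeSplit.pos_of_klBetaMin_le hβmin) ht0 ht1 D

/-- **THE CHILD `…Theses.KLProgramme.KLRegimeVolumeLimitV17F3` FROM THREE ENGINE-LINEAGE ATOMS** — `stub_vl_HE1free`'s text, the (K5′) export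
`HOsc`, the UV levels `HUV`: the producer `srcProfilesH_of_atoms`, the data consumer `vl_towerDataW_WF2_of_HE1free_srcH`, the truncated closer
`vl_nestedFramed_of_towerDataTSW_srcH`, the re-keyed text `volumeLimitTextV17F3_of_framedNestedFlowText`. [cite: BenfattoGiulianiMastropietro2006, §2.7-§2.9, §3] -/
theorem KLRegimeVolumeLimitV17F3_of_atoms
    (HE1free : (∀ (P : SplitConsts) (R : RenConsts), P.WF → R.WF2 →
      ∃ Q₁ : EngConsts, 0 ≤ Q₁.CE ∧ ∃ C₀ : ℝ, 0 ≤ C₀ ∧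
        ∃ c₇ : ℝ, 0 < c₇ ∧ ∀ c : ℝ, 0 < c → c ≤ c₇ → ∃ U₇ : ℝ, 0 < U₇ ∧
          ∀ μ ∈ klWindowC, ∀ U : ℝ, 0 < U → U ≤ U₇ → ∀ β : ℝ, klBetaMin ≤ β → β ≤ Real.exp (c / U ^ 2) →
            ∃ S₀ : ℕ → ℕ → ℝ, (∀ j m, 0 ≤ S₀ j m) ∧ (∀ j, j ≤ nScales β → ∀ m, 1 ≤ m → S₀ j (2 * m) ≤ C₀ * klWtBudget P Q₁ U (j + 1) (2 * m)) ∧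
            ∃ L₂ : ℕ, ∃ M₂ : ℕ → ℕ, ∀ (L M : ℕ) [NeZero L] [NeZero M], L₂ ≤ L → M₂ L ≤ M →
              (∀ k, k ≤ nScales β → hubbardEffPartitionFnCT L M β U μ 0 (klFlowFrameU L M β U μ (nScales β + 1)) (klScale klE0 (k + 1)) ≠ 0) ∧
              (∀ j, j ≤ nScales β → ∀ (m : ℕ) (q : Fin m) (w : SpaceTimeIdx L M × SectorLeg (sectorCount j)),
                klWtPinnedSumAt L M β μ (klFlowFrameU L M β U μ (nScales β + 1)) j j m (klEffectiveAction L M β U μ (klFlowFrameU L M β U μ (nScales β + 1)) klE0 (j + 1)) q w ≤ S₀ j m)))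
    (HOsc : (∀ (P : SplitConsts) (R : RenConsts), P.WF → R.WF2 →
      ∃ c₇ : ℝ, 0 < c₇ ∧ ∀ c : ℝ, 0 < c → c ≤ c₇ → ∃ U₇ : ℝ, 0 < U₇ ∧
        ∀ μ ∈ klWindowC, ∀ U : ℝ, 0 < U → U ≤ U₇ → ∀ β : ℝ, klBetaMin ≤ β → β ≤ Real.exp (c / U ^ 2) →
          ∃ L₂ : ℕ, ∃ M₂ : ℕ → ℕ, ∀ (L M : ℕ) [NeZero L] [NeZero M], L₂ ≤ L → M₂ L ≤ M →
            ∀ m : ℕ, 1 ≤ m → m < nScales β + 1 → FlowPieceOscAt L M (klReadOscC P R) β U μ m))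
    (HUV : (∀ (P : SplitConsts) (R : RenConsts), P.WF → R.WF2 →
      ∃ Q₀ : EngConsts, 0 ≤ Q₀.CE ∧ ∃ c₀ : ℝ, 0 < c₀ ∧ ∀ c : ℝ, 0 < c → c ≤ c₀ → ∃ U₀ : ℝ, 0 < U₀ ∧
        ∀ μ ∈ klWindowC, ∀ U : ℝ, 0 < U → U ≤ U₀ → ∀ β : ℝ, klBetaMin ≤ β → β ≤ Real.exp (c / U ^ 2) →
          ∃ A₀ : ℝ, 0 ≤ A₀ ∧ ∃ L₁ : ℕ, ∃ M₁ : ℕ → ℕ, ∀ (L M : ℕ) [NeZero L] [NeZero M], L₁ ≤ L → M₁ L ≤ M →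
            ∀ j : ℕ, j ≤ 1 → j + 1 ≤ nScales β + 1 →
              SourceProfilesAtLev L M (klSrcBudget P Q₀ U (fun _ _ => A₀) (j + 1)) β U μ (klFlowFrameU L M β U μ (nScales β + 1)) j j (j + 1))) :
    Summit.HubbardSuperconductivity.HubbardSuperconductivity.Theses.KLProgramme.KLRegimeVolumeLimitV17F3 :=
  volumeLimitTextV17F3_of_framedNestedFlowText
    (vl_nestedFramed_of_towerDataTSW_srcH (srcProfilesH_of_atoms HE1free HOsc HUV)
      (vl_towerDataW_WF2_of_HE1free_srcH HE1free (srcProfilesH_of_atoms HE1free HOsc HUV)))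

end Summit.HubbardSuperconductivity.HubbardSuperconductivity.Theorems.TwoVolumeSource

end
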